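import Mathlib
import HarnessLib

/-!
# Crux `SystemMomentDeficit` (stmt-Parity-11326), line `Ideator3Sketch`: `stub_pairBookkeeping`

Stub S3c (pair bookkeeping) of the line skeleton
`Summit.Parity.BatemanHorn.Cruxes.SystemMomentDeficit.Ideator3Sketch` for the crux
`Summit.Parity.BatemanHorn.Theses.AlmostPrimeZeros.SystemMomentDeficit`.

With `PP(x) = {p ≤ x : p prime} ∪ {p² : p prime, p² ≤ x}` (the Finset
`Nat.primesLE x ∪ ((Nat.primesLE x).filter (fun p => p ^ 2 ≤ x)).image (fun p => p ^ 2)`):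

* (i) `#{(q, q') ∈ PP(x)² : q, q' coprime, qq' ≤ x} ≤ 2(x+1)`: the product map
  `(q, q') ↦ qq'` lands in `[0, x]` and is at most two-to-one, because in a fibre over `m` the pair
  is determined by the prime below `q` (the `p`-part of `m`), and `m = qq'` has at most two prime
  factors;
* (ii) `Σ_{(q, q') ∈ PP(x)², ¬ coprime} 1/(qq') ≤ 8`: non-coprime pairs are `(p^a, p^b)` with the
  same prime `p ≤ x` and `a, b ∈ {1, 2}`, each term is `≤ 1/p²`, and `Σ_p 4/p² ≤ 4`.

Everything is [folklore]; no definitions are introduced.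
-/

namespace Summit.Parity.BatemanHorn.Cruxes.SystemMomentDeficit.Ideator3Sketch

open Finset

/-- Elements of `PP(x)` are `p ^ k` with `p ≤ x` prime and `k ∈ {1, 2}`. [folklore] -/
private theorem exists_prime_pow_eq_of_mem_primePowersLE {x q : ℕ}
    (hq : q ∈ Nat.primesLE x ∪ ((Nat.primesLE x).filter (fun p => p ^ 2 ≤ x)).image (fun p => p ^ 2)) :
    ∃ p ∈ Nat.primesLE x, ∃ k ∈ ({1, 2} : Finset ℕ), q = p ^ k := by
  rcases mem_union.mp hq with h | h
  · exact ⟨q, h, 1, by simp, (pow_one q).symm⟩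
  · obtain ⟨p, hp, rfl⟩ := mem_image.mp h
    exact ⟨p, (mem_filter.mp hp).1, 2, by simp, rfl⟩

/-- Elements of `PP(x)` are prime powers. [folklore] -/
private theorem isPrimePow_of_mem_primePowersLE {x q : ℕ}
    (hq : q ∈ Nat.primesLE x ∪ ((Nat.primesLE x).filter (fun p => p ^ 2 ≤ x)).image (fun p => p ^ 2)) :
    IsPrimePow q := by
  obtain ⟨p, hp, k, hk, rfl⟩ := exists_prime_pow_eq_of_mem_primePowersLE hq
  refine (isPrimePow_nat_iff _).mpr ⟨p, k, Nat.prime_of_mem_primesLE hp, ?_, rfl⟩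
  simp only [mem_insert, mem_singleton] at hk
  omega

/-- Fibres of the product map on coprime pairs of prime powers have at most two elements: in the
fibre over `m`, the pair `(q, q')` is determined by the prime below `q` (then `q` is the full power of
that prime in `m` and `q' = m / q`), and that prime is one of the at most two prime factors of
`m = qq'`. [folklore] -/
private theorem card_filter_mul_eq_le_two {S : Finset (ℕ × ℕ)}
    (hS : ∀ qq ∈ S, IsPrimePow qq.1 ∧ IsPrimePow qq.2 ∧ Nat.Coprime qq.1 qq.2) (m : ℕ) :
    #(S.filter (fun qq : ℕ × ℕ => qq.1 * qq.2 = m)) ≤ 2 := by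
  set T := S.filter (fun qq : ℕ × ℕ => qq.1 * qq.2 = m) with hTdef
  have hT : ∀ qq ∈ T, ∃ p a : ℕ, p.Prime ∧ 0 < a ∧ qq.1 = p ^ a ∧ IsPrimePow qq.2 ∧
      Nat.Coprime qq.1 qq.2 ∧ qq.1 * qq.2 = m := by
    intro qq hqq
    obtain ⟨hqS, hm⟩ := mem_filter.mp hqq
    obtain ⟨h1, h2, hc⟩ := hS qq hqS
    obtain ⟨p, a, hp, ha, hpa⟩ := (isPrimePow_nat_iff _).mp h1
    exact ⟨p, a, hp, ha, hpa.symm, h2, hc, hm⟩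
  rcases T.eq_empty_or_nonempty with h0 | ⟨qq₀, hqq₀⟩
  · rw [h0, card_empty]
    exact Nat.zero_le _
  obtain ⟨p₀, a₀, hp₀, ha₀, h₀1, h₀2, -, hm₀⟩ := hT qq₀ hqq₀
  obtain ⟨p₀', b₀, hp₀', hb₀, h₀2'⟩ := (isPrimePow_nat_iff _).mp h₀2
  calc #T ≤ #m.primeFactors := by
        refine card_le_card_of_injOn (fun qq : ℕ × ℕ => qq.1.minFac) (fun qq hqq => ?_) ?_
        · obtain ⟨p, a, hp, ha, h1, h2, -, hm⟩ := hT qq (mem_coe.mp hqq)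
          have hq1 : qq.1 ≠ 0 := by rw [h1]; exact pow_ne_zero _ hp.ne_zero
          show qq.1.minFac ∈ (m.primeFactors : Set ℕ)
          rw [mem_coe, Nat.mem_primeFactors, h1, hp.pow_minFac ha.ne']
          refine ⟨hp, ?_, ?_⟩
          · rw [← hm, h1]
            exact dvd_mul_of_dvd_left (dvd_pow_self p ha.ne') _
          · rw [← hm]
            exact mul_ne_zero hq1 h2.ne_zero
        · intro qq₁ hqq₁ qq₂ hqq₂ heq
          obtain ⟨p₁, a₁, hp₁, ha₁, h₁1, -, hc₁, hm₁⟩ := hT qq₁ (mem_coe.mp hqq₁)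
          obtain ⟨p₂, a₂, hp₂, ha₂, h₂1, -, hc₂, hm₂⟩ := hT qq₂ (mem_coe.mp hqq₂)
          have hp : p₁ = p₂ := by
            have h := heq
            dsimp only at h
            rwa [h₁1, h₂1, hp₁.pow_minFac ha₁.ne', hp₂.pow_minFac ha₂.ne'] at h
          have h₂1' : qq₂.1 = p₁ ^ a₂ := by rw [hp]; exact h₂1
          have hd₁ : p₁ ∣ qq₁.1 := by rw [h₁1]; exact dvd_pow_self p₁ ha₁.ne'
          have hd₂ : p₁ ∣ qq₂.1 := by rw [h₂1']; exact dvd_pow_self p₁ ha₂.ne'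
          have hc₁' : Nat.Coprime p₁ qq₁.2 := Nat.Coprime.coprime_dvd_left hd₁ hc₁
          have hc₂' : Nat.Coprime p₁ qq₂.2 := Nat.Coprime.coprime_dvd_left hd₂ hc₂
          have key : ∀ {q n q' n' a : ℕ}, q = p₁ ^ a → Nat.Coprime p₁ n' → q * n = m →
              q' * n' = m → q ∣ q' := by
            intro q n q' n' a hq hn' h h'
            have hd : q ∣ q' * n' := by rw [h', ← h]; exact dvd_mul_right q n
            rw [hq] at hd ⊢
            exact (Nat.Coprime.pow_left a hn').dvd_of_dvd_mul_right hd
          have hfst : qq₁.1 = qq₂.1 :=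
            Nat.dvd_antisymm (key h₁1 hc₂' hm₁ hm₂) (key h₂1' hc₁' hm₂ hm₁)
          have hq0 : 0 < qq₁.1 := by rw [h₁1]; exact pow_pos hp₁.pos a₁
          have hsnd : qq₁.2 = qq₂.2 := Nat.eq_of_mul_eq_mul_left hq0 (by rw [hm₁, hfst, hm₂])
          exact Prod.ext hfst hsnd
    _ ≤ 2 := by
        rw [← hm₀, h₀1, ← h₀2', Nat.primeFactors_mul (pow_ne_zero _ hp₀.ne_zero)
          (pow_ne_zero _ hp₀'.ne_zero), Nat.primeFactors_prime_pow ha₀.ne' hp₀,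
          Nat.primeFactors_prime_pow hb₀.ne' hp₀']
        exact (card_union_le _ _).trans (by simp)

/-- (i) `#{(q, q') ∈ PP(x)² : q, q' coprime, qq' ≤ x} ≤ 2(x+1)`: the product map into
`range (x+1)` is at most two-to-one (`card_filter_mul_eq_le_two`). [folklore] -/
private theorem card_coprime_pairs_le (x : ℕ) :
    #(((Nat.primesLE x ∪ ((Nat.primesLE x).filter (fun p => p ^ 2 ≤ x)).image (fun p => p ^ 2)) ×ˢ
          (Nat.primesLE x ∪ ((Nat.primesLE x).filter (fun p => p ^ 2 ≤ x)).image (fun p => p ^ 2))).filter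
        (fun qq : ℕ × ℕ => Nat.Coprime qq.1 qq.2 ∧ qq.1 * qq.2 ≤ x)) ≤ 2 * (x + 1) := by
  set PP := Nat.primesLE x ∪ ((Nat.primesLE x).filter (fun p => p ^ 2 ≤ x)).image (fun p => p ^ 2)
    with hPP
  set S := (PP ×ˢ PP).filter (fun qq : ℕ × ℕ => Nat.Coprime qq.1 qq.2 ∧ qq.1 * qq.2 ≤ x) with hS
  have hS' : ∀ qq ∈ S, IsPrimePow qq.1 ∧ IsPrimePow qq.2 ∧ Nat.Coprime qq.1 qq.2 := by
    intro qq hqq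
    obtain ⟨hmem, hc, -⟩ := mem_filter.mp hqq
    obtain ⟨h1, h2⟩ := mem_product.mp hmem
    exact ⟨isPrimePow_of_mem_primePowersLE h1, isPrimePow_of_mem_primePowersLE h2, hc⟩
  calc #S ≤ 2 * #(range (x + 1)) :=
        card_le_mul_card_image_of_maps_to (f := fun qq : ℕ × ℕ => qq.1 * qq.2)
          (fun qq hqq => mem_range.mpr (Nat.lt_succ_of_le (mem_filter.mp hqq).2.2)) 2
          (fun m _ => card_filter_mul_eq_le_two hS' m)
    _ = 2 * (x + 1) := by rw [card_range]

/-- `Σ_{p ≤ x prime} 1/p² ≤ 1` (compare with `Σ_{1 < n ≤ x} 1/n² ≤ 1 − 1/x`,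
`sum_Ioc_inv_sq_le_sub`). [folklore] -/
private theorem sum_primesLE_inv_sq_le_one' (x : ℕ) :
    ∑ p ∈ Nat.primesLE x, ((p : ℝ) ^ 2)⁻¹ ≤ 1 := by
  rcases Nat.eq_zero_or_pos x with rfl | hx
  · simp
  calc ∑ p ∈ Nat.primesLE x, ((p : ℝ) ^ 2)⁻¹ ≤ ∑ i ∈ Ioc 1 x, ((i : ℝ) ^ 2)⁻¹ := by
        refine sum_le_sum_of_subset_of_nonneg (fun p hp => ?_) (fun _ _ _ => by positivity)
        obtain ⟨hpx, hp⟩ := Nat.mem_primesLE.mp hp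
        exact mem_Ioc.mpr ⟨hp.one_lt, hpx⟩
    _ ≤ ((1 : ℕ) : ℝ)⁻¹ - (x : ℝ)⁻¹ := sum_Ioc_inv_sq_le_sub one_ne_zero hx
    _ ≤ 1 := by rw [Nat.cast_one, inv_one]; exact sub_le_self _ (by positivity)

/-- (ii) `Σ_{(q, q') ∈ PP(x)², ¬ coprime} 1/(qq') ≤ 8`: non-coprime pairs are `(p^a, p^b)` with
one prime `p ≤ x` and `a, b ∈ {1, 2}`; each term is `≤ 1/p²` and `Σ_p 4/p² ≤ 4`. [folklore] -/
private theorem sum_not_coprime_pairs_le (x : ℕ) :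
    ∑ qq ∈ ((Nat.primesLE x ∪ ((Nat.primesLE x).filter (fun p => p ^ 2 ≤ x)).image (fun p => p ^ 2)) ×ˢ
          (Nat.primesLE x ∪ ((Nat.primesLE x).filter (fun p => p ^ 2 ≤ x)).image (fun p => p ^ 2))).filter
        (fun qq : ℕ × ℕ => ¬ Nat.Coprime qq.1 qq.2),
      (1 : ℝ) / ((qq.1 : ℝ) * (qq.2 : ℝ)) ≤ 8 := by
  set PP := Nat.primesLE x ∪ ((Nat.primesLE x).filter (fun p => p ^ 2 ≤ x)).image (fun p => p ^ 2)
    with hPP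
  set g : ℕ × (ℕ × ℕ) → ℕ × ℕ := fun t => (t.1 ^ t.2.1, t.1 ^ t.2.2) with hg
  have hsub : (PP ×ˢ PP).filter (fun qq : ℕ × ℕ => ¬ Nat.Coprime qq.1 qq.2) ⊆
      (Nat.primesLE x ×ˢ (({1, 2} : Finset ℕ) ×ˢ ({1, 2} : Finset ℕ))).image g := by
    intro qq hqq
    obtain ⟨hmem, hnc⟩ := mem_filter.mp hqq
    obtain ⟨h1, h2⟩ := mem_product.mp hmem
    obtain ⟨p, hp, a, ha, hqa⟩ := exists_prime_pow_eq_of_mem_primePowersLE h1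
    obtain ⟨p', hp', b, hb, hqb⟩ := exists_prime_pow_eq_of_mem_primePowersLE h2
    have hpp' : p = p' := by
      by_contra hne
      apply hnc
      rw [hqa, hqb]
      exact Nat.Coprime.pow a b ((Nat.coprime_primes (Nat.prime_of_mem_primesLE hp)
        (Nat.prime_of_mem_primesLE hp')).mpr hne)
    refine mem_image.mpr ⟨(p, (a, b)), mem_product.mpr ⟨hp, mem_product.mpr ⟨ha, ?_⟩⟩, ?_⟩
    · rw [hpp']; exact hb
    · rw [hg]; exact Prod.ext hqa.symm (hpp' ▸ hqb).symm
  have hf0 : ∀ qq : ℕ × ℕ, 0 ≤ (1 : ℝ) / ((qq.1 : ℝ) * (qq.2 : ℝ)) := fun qq => by positivity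
  have hcard : #(({1, 2} : Finset ℕ) ×ˢ ({1, 2} : Finset ℕ)) = 4 := by decide
  calc ∑ qq ∈ (PP ×ˢ PP).filter (fun qq : ℕ × ℕ => ¬ Nat.Coprime qq.1 qq.2),
          (1 : ℝ) / ((qq.1 : ℝ) * (qq.2 : ℝ))
        ≤ ∑ qq ∈ (Nat.primesLE x ×ˢ (({1, 2} : Finset ℕ) ×ˢ ({1, 2} : Finset ℕ))).image g,
            (1 : ℝ) / ((qq.1 : ℝ) * (qq.2 : ℝ)) :=
          sum_le_sum_of_subset_of_nonneg hsub fun qq _ _ => hf0 qq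
    _ ≤ ∑ t ∈ Nat.primesLE x ×ˢ (({1, 2} : Finset ℕ) ×ˢ ({1, 2} : Finset ℕ)),
            (1 : ℝ) / (((g t).1 : ℝ) * ((g t).2 : ℝ)) :=
          sum_image_le_of_nonneg fun qq _ => hf0 qq
    _ ≤ ∑ t ∈ Nat.primesLE x ×ˢ (({1, 2} : Finset ℕ) ×ˢ ({1, 2} : Finset ℕ)),
            ((t.1 : ℝ) ^ 2)⁻¹ := by
          refine sum_le_sum fun t ht => ?_
          obtain ⟨hp, he⟩ := mem_product.mp ht
          obtain ⟨ha, hb⟩ := mem_product.mp he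
          have hp' := Nat.prime_of_mem_primesLE hp
          have hp1 : (1 : ℝ) ≤ t.1 := by exact_mod_cast hp'.one_le
          have hp0 : (0 : ℝ) < t.1 := by exact_mod_cast hp'.pos
          have ha1 : 1 ≤ t.2.1 := by
            simp only [mem_insert, mem_singleton] at ha
            omega
          have hb1 : 1 ≤ t.2.2 := by
            simp only [mem_insert, mem_singleton] at hb
            omega
          simp only [hg, Nat.cast_pow, one_div]
          refine inv_anti₀ (pow_pos hp0 2) ?_
          rw [← pow_add]
          exact pow_le_pow_right₀ hp1 (by omega)
    _ = ∑ p ∈ Nat.primesLE x, ∑ _e ∈ ({1, 2} : Finset ℕ) ×ˢ ({1, 2} : Finset ℕ),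
            ((p : ℝ) ^ 2)⁻¹ := sum_product _ _ _
    _ = 4 * ∑ p ∈ Nat.primesLE x, ((p : ℝ) ^ 2)⁻¹ := by
          rw [mul_sum]
          refine sum_congr rfl fun p _ => ?_
          rw [sum_const, hcard, nsmul_eq_mul, Nat.cast_ofNat]
    _ ≤ 4 * 1 := by
          gcongr
          exact sum_primesLE_inv_sq_le_one' x
    _ ≤ 8 := by norm_num

/-- **Stub S3c (pair bookkeeping).** With `PP(x) = {p ≤ x prime} ∪ {p² : p prime, p² ≤ x}`:
(i) the coprime pairs `(q, q') ∈ PP(x)²` with `qq' ≤ x` number at most `2(x+1)` (the product map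
into `[0, x]` is at most two-to-one); (ii) the non-coprime pairs (both coordinates powers of the
same prime) have `Σ 1/(qq') ≤ 8`. [folklore] -/
theorem stub_pairBookkeeping :
    ∀ x : ℕ,
      #(((Nat.primesLE x ∪ ((Nat.primesLE x).filter (fun p => p ^ 2 ≤ x)).image (fun p => p ^ 2)) ×ˢ
            (Nat.primesLE x ∪ ((Nat.primesLE x).filter (fun p => p ^ 2 ≤ x)).image (fun p => p ^ 2))).filter
          (fun qq : ℕ × ℕ => Nat.Coprime qq.1 qq.2 ∧ qq.1 * qq.2 ≤ x)) ≤ 2 * (x + 1) ∧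
      ∑ qq ∈ ((Nat.primesLE x ∪ ((Nat.primesLE x).filter (fun p => p ^ 2 ≤ x)).image (fun p => p ^ 2)) ×ˢ
            (Nat.primesLE x ∪ ((Nat.primesLE x).filter (fun p => p ^ 2 ≤ x)).image (fun p => p ^ 2))).filter
          (fun qq : ℕ × ℕ => ¬ Nat.Coprime qq.1 qq.2),
        (1 : ℝ) / ((qq.1 : ℝ) * (qq.2 : ℝ)) ≤ 8 :=
  fun x => ⟨card_coprime_pairs_le x, sum_not_coprime_pairs_le x⟩

end Summit.Parity.BatemanHorn.Cruxes.SystemMomentDeficit.Ideator3Sketch
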